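import Summits.ResolutionOfSingularities.ResolutionOfSingularities.Theorems.EquisingularLiftEquisingularLiftNatStubElnatCiNoseThenPoints
import Summits.ResolutionOfSingularities.ResolutionOfSingularities.Theorems.EquisingularLiftEquisingularLiftNatSpecimenFermatConeCiNose
import Summits.ResolutionOfSingularities.ResolutionOfSingularities.Theorems.EquisingularLiftEquisingularLiftNatSpecimenWhitneyCubicCiNose
import Summits.ResolutionOfSingularities.ResolutionOfSingularities.Theorems.EquisingularLiftEquisingularLiftNatResidualCut
import Summits.ResolutionOfSingularities.ResolutionOfSingularities.Theorems.EquisingularLiftEquisingularLiftProjectiveAmbientSmoothProper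
import Literature.AlgebraicGeometry.Motives.HypersurfaceCharts
import Literature.AlgebraicGeometry.Motives.HypersurfaceChartAlgebra
import HarnessLib

/-!
# [OURS · L1 W4.5(b) · EL♮(3)] The CLOSED registered stub `stub_elnat_ciNoseThenPoints` FIRES on the two certified specimens: the «locally principal»
# binder for reduced hypersurfaces, and EL♮ for the Fermat cones / the Whitney-type cubic re-derived THROUGH the rung
# (crux `EquisingularLiftNatThree` stmt-ResolutionOfSingularities-20148 / parent stmt-20038)

NOT a statement of any manuscript; OURS (cell `res-hironaka`, chain w45b; seat res-D-pv-013, own initiative, counted 0). AI-written, weaker than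
expert review. No definition, no `sorry`, standard axioms.

`stub_elnat_ciNoseThenPoints` is a THEOREM since p524326 (res-D-pv-027 AS s36-pv-4 ∘ res-type-051 ∘ res-L1-w45b-lead-2). Besides the downstairs
∃-block (certified for the Fermat cones by `FermatCone.ciNoseThenPoints_hypothesis_fermatCone` p519455 and for R2 by
`WhitneyCubic.ciNoseThenPoints_hypothesis_whitneyCubic` p522054) every registered rung of the chain carries the item's «LOCALLY PRINCIPAL» binder
`∀ y, ∃ U affine ∋ y, (ι.ker.ideal U).IsPrincipal`. This file discharges it once and for all for the tree's reduced hypersurfaces and then runs the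
rung END-TO-END:

* `exists_mem_coordChartOpen` — every point of `ℙⁿ⁺¹_k` lies in some `D₊(x_c)`;
* `chartIdeal_eq_span_chartEqn` — for a homogeneous `F` whose dehomogenisation `F(x_c := 1)` spans a RADICAL ideal, the chart ideal `√(F/x_cᵉ)`
  is `(F/x_cᵉ)` itself; `isPrincipal_ker_ideal_coordChartOpen`, **`locallyPrincipal_hypersurfaceι`** — hence `ι = hypersurfaceι F` has principal
  kernel ideal on every `D₊(x_c)` (Mathlib `ker_subschemeι`, tree `idealSheaf_ideal_coordChartOpen`): the binder, for ANY `n`;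
* `elNatAt_fermatCone_of_ciNose`, `elNatAt_whitneyCubic_of_ciNose` — the rung applied to the two certificates, then `elNatAt_of_horizAt`
  (p500485 glue): `ELNatAt p K 3 H ι` for both specimens, now THROUGH the registered stub (second, independent derivations of
  `FermatCone.elNatAt_fermatCone` p518711 and `WhitneyCubic.elNatAt_whitneyCubic` p511043) — an end-to-end test that the closed rung's
  hypotheses are dischargeable and its conclusion is the item's.
-/

set_option linter.dupNamespace false -- mandated namespace `Summit.<Summit>.<Problem>` of this single-conjunct summit

noncomputable section

open CategoryTheory AlgebraicGeometry TopologicalSpace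
open MvPolynomial HomogeneousLocalization
open Literature.AlgebraicGeometry.Resolution
open Literature.AlgebraicGeometry.Motives Literature.AlgebraicGeometry.Motives.SmoothHypersurface
open Literature.AlgebraicGeometry.Motives.ProjectiveSpace
open AlgebraicGeometry.Scheme.IdealSheafData

namespace Summit.ResolutionOfSingularities.ResolutionOfSingularities.Cruxes.EquisingularLiftNat.Sections

namespace HypersurfaceSpecimen

variable {k : Type} [Field k] {n : ℕ}

attribute [local instance] MvPolynomial.gradedAlgebra ProjBaseChange.algebraBase

/-! ## Every point lies in a standard chart -/

/-- Every point of `ℙⁿ⁺¹_k` lies in some `D₊(x_c)` (the variables generate the irrelevant ideal). [folklore] -/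
theorem exists_mem_coordChartOpen (x : Proj (homogeneousSubmodule (Fin (n + 2)) k)) :
    ∃ c : Fin (n + 2), x ∈ Proj.basicOpen (homogeneousSubmodule (Fin (n + 2)) k) (X c) := by
  by_contra! h
  simp only [Proj.mem_basicOpen, not_not] at h
  refine x.not_irrelevant_le fun a ha => ?_
  exact Ideal.span_le.mpr (Set.range_subset_iff.mpr h)
    (Summit.ResolutionOfSingularities.ResolutionOfSingularities.Cruxes.EquisingularLift.StrataSplit.irrelevant_le_span (n + 1) k ha)

/-! ## The chart ideal of a hypersurface with radical dehomogenisations is principal -/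

/-- For a homogeneous `F ∈ k[x₀,…,x_{n+1}]` whose dehomogenisation `F(x_c := 1)` spans a radical ideal of `k[y]`, the chart ideal
`√(F/x_cᵉ) ⊆ (k[x]_{(x_c)})₀` is `(F/x_cᵉ)` itself. [folklore] -/
theorem chartIdeal_eq_span_chartEqn (F : MvPolynomial (Fin (n + 2)) k) {e : ℕ} (hF : F.IsHomogeneous e) (c : Fin (n + 2))
    (hrad : (Ideal.span {dehomogenize k c F}).radical = Ideal.span {dehomogenize k c F}) :
    chartIdeal F c hF = Ideal.span {chartEqn F c hF} := by
  have h1 : chartAlgEquiv k c (chartEqn F c hF) = dehomogenize k c F := by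
    rw [chartEqn, isLocalizationElem_X]
    exact (chartAlgEquiv k c).apply_symm_apply _
  have hmapspan : (Ideal.span {chartEqn F c hF}).map (chartAlgEquiv k c).toRingEquiv.toRingHom = Ideal.span {dehomogenize k c F} := by
    rw [Ideal.map_span, Set.image_singleton]
    exact congrArg (fun q => Ideal.span {q}) h1
  have hspan : Ideal.span {chartEqn F c hF} = (Ideal.span {dehomogenize k c F}).comap (chartAlgEquiv k c).toRingEquiv.toRingHom := by
    rw [← hmapspan]
    exact (Ideal.comap_map_of_bijective (chartAlgEquiv k c).toRingEquiv.toRingHom (chartAlgEquiv k c).toRingEquiv.bijective).symm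
  rw [chartIdeal, hspan, ← Ideal.comap_radical, hrad]

/-- **On `D₊(x_c)` the kernel ideal of `ι = hypersurfaceι F` is principal** (generated by the section `F/x_cᵉ`), for `F` homogeneous of positive
degree with radical dehomogenisation at `c`. [folklore] -/
theorem isPrincipal_ker_ideal_coordChartOpen (F : MvPolynomial (Fin (n + 2)) k) {e : ℕ} (hF : F.IsHomogeneous e) (he : 0 < e)
    (c : Fin (n + 2)) (hrad : (Ideal.span {dehomogenize k c F}).radical = Ideal.span {dehomogenize k c F}) :
    ((hypersurfaceι F).left.ker.ideal (coordChartOpen k c)).IsPrincipal := by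
  have hI : ((idealSheaf F).ideal (coordChartOpen k c)).IsPrincipal := by
    rw [idealSheaf_ideal_coordChartOpen F c hF he, chartIdeal_eq_span_chartEqn F hF c hrad, Ideal.map_span, Set.image_singleton]
    exact ⟨⟨_, rfl⟩⟩
  have hk : (hypersurfaceι F).left.ker = idealSheaf F := Scheme.IdealSheafData.ker_subschemeι _
  rw [hk]
  exact hI

/-- **THE «LOCALLY PRINCIPAL» BINDER for reduced hypersurfaces**: for `F ∈ k[x₀,…,x_{n+1}]` homogeneous of positive degree all of whose
dehomogenisations span radical ideals, every point of `ℙⁿ⁺¹_k` has an affine neighbourhood (`D₊(x_c)`) on which the kernel ideal of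
`ι = hypersurfaceι F` is principal — the binder `hloc` of the item `EquisingularLiftNat` and of every registered rung. [folklore] -/
theorem locallyPrincipal_hypersurfaceι (F : MvPolynomial (Fin (n + 2)) k) {e : ℕ} (hF : F.IsHomogeneous e) (he : 0 < e)
    (hrad : ∀ c : Fin (n + 2), (Ideal.span {dehomogenize k c F}).radical = Ideal.span {dehomogenize k c F}) :
    ∀ y : (Literature.AlgebraicGeometry.Motives.projectiveSpace (n + 1) k).left,
      ∃ U : (Literature.AlgebraicGeometry.Motives.projectiveSpace (n + 1) k).left.affineOpens,
        y ∈ (U : (Literature.AlgebraicGeometry.Motives.projectiveSpace (n + 1) k).left.Opens) ∧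
          ((hypersurfaceι F).left.ker.ideal U).IsPrincipal := by
  intro y
  obtain ⟨c, hc⟩ := exists_mem_coordChartOpen (k := k) (n := n) y
  exact ⟨coordChartOpen k c, hc, isPrincipal_ker_ideal_coordChartOpen F hF he c (hrad c)⟩

end HypersurfaceSpecimen

/-! ## The closed rung fires on the two certified specimens -/

/-- **EL♮ for the Fermat cones THROUGH the registered rung**: `stub_elnat_ciNoseThenPoints` (p524326) applied to
`FermatCone.ciNoseThenPoints_hypothesis_fermatCone` (p519455), the locally-principal binder discharged by `locallyPrincipal_hypersurfaceι`,
then `elNatAt_of_horizAt`. (Independent of `FermatCone.elNatAt_fermatCone`, p518711.) [OURS · L1 W4.5b] [folklore] -/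
theorem FermatCone.elNatAt_fermatCone_of_ciNose (d p : ℕ) (hp : p.Prime) (K : Type) [Field K] [CharP K p] [IsAlgClosed K]
    (hdK : (d : K) ≠ 0) :
    Theorems.EquisingularLift.ELNatAt p K 3 (hypersurface (FermatCone.form K d)).left (hypersurfaceι (FermatCone.form K d)).left := by
  haveI := FermatCone.isIntegral_hypersurface K d hdK
  have hd : 0 < d := Nat.pos_of_ne_zero (by rintro rfl; exact hdK (by simp))
  have hrad : ∀ c : Fin (2 + 2), (Ideal.span {dehomogenize K c (FermatCone.form K d)}).radical =
      Ideal.span {dehomogenize K c (FermatCone.form K d)} := by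
    intro c
    by_cases hc : c = 0
    · subst hc
      rw [FermatCone.dehomogenize_form_zero]
      exact FermatCone.radical_span_f₀ K d hdK
    · rw [FermatCone.dehomogenize_form_of_ne_zero K d c hc]
      exact FermatCone.radical_span_f₁ K d hdK
  exact Summit.ResolutionOfSingularities.ResolutionOfSingularities.Theorems.EquisingularLiftNatResidualCut.elNatAt_of_horizAt
    p K 3 _ _ inferInstance inferInstance
    (stub_elnat_ciNoseThenPoints p hp K 3 _ _ inferInstance inferInstance
      (HypersurfaceSpecimen.locallyPrincipal_hypersurfaceι (FermatCone.form K d) (FermatCone.isHomogeneous_form K d) hd hrad)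
      (FermatCone.ciNoseThenPoints_hypothesis_fermatCone d p K hdK))

/-- **EL♮ for the Whitney-type cubic THROUGH the registered rung**: `stub_elnat_ciNoseThenPoints` (p524326) applied to
`WhitneyCubic.ciNoseThenPoints_hypothesis_whitneyCubic` (p522054; `Σ` the double LINE). (Independent of `WhitneyCubic.elNatAt_whitneyCubic`,
p511043.) [OURS · L1 W4.5b] [folklore] -/
theorem WhitneyCubic.elNatAt_whitneyCubic_of_ciNose (p : ℕ) (hp : p.Prime) (K : Type) [Field K] [CharP K p] [IsAlgClosed K] :
    Theorems.EquisingularLift.ELNatAt p K 3 (hypersurface (WhitneyCubic.form K)).left (hypersurfaceι (WhitneyCubic.form K)).left := by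
  haveI := WhitneyCubic.isIntegral_hypersurface K
  have hrad : ∀ c : Fin (2 + 2), (Ideal.span {dehomogenize K c (WhitneyCubic.form K)}).radical =
      Ideal.span {dehomogenize K c (WhitneyCubic.form K)} := by
    intro c
    fin_cases c
    · exact (congrArg (fun q => (Ideal.span {q}).radical) (WhitneyCubic.dehomogenize_form_zero K)).trans
        ((WhitneyCubic.radical_span_f₀ K).trans (congrArg (fun q => Ideal.span {q}) (WhitneyCubic.dehomogenize_form_zero K).symm))
    · exact (congrArg (fun q => (Ideal.span {q}).radical) (WhitneyCubic.dehomogenize_form_one K)).trans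
        ((WhitneyCubic.radical_span_f₁ K).trans (congrArg (fun q => Ideal.span {q}) (WhitneyCubic.dehomogenize_form_one K).symm))
    · exact (congrArg (fun q => (Ideal.span {q}).radical) (WhitneyCubic.dehomogenize_form_two K)).trans
        ((WhitneyCubic.radical_span_f₂ K).trans (congrArg (fun q => Ideal.span {q}) (WhitneyCubic.dehomogenize_form_two K).symm))
    · exact (congrArg (fun q => (Ideal.span {q}).radical) (WhitneyCubic.dehomogenize_form_three K)).trans
        ((WhitneyCubic.radical_span_f₃ K).trans (congrArg (fun q => Ideal.span {q}) (WhitneyCubic.dehomogenize_form_three K).symm))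
  exact Summit.ResolutionOfSingularities.ResolutionOfSingularities.Theorems.EquisingularLiftNatResidualCut.elNatAt_of_horizAt
    p K 3 _ _ inferInstance inferInstance
    (stub_elnat_ciNoseThenPoints p hp K 3 _ _ inferInstance inferInstance
      (HypersurfaceSpecimen.locallyPrincipal_hypersurfaceι (WhitneyCubic.form K) (WhitneyCubic.isHomogeneous_form K) three_pos hrad)
      (WhitneyCubic.ciNoseThenPoints_hypothesis_whitneyCubic K))

end Summit.ResolutionOfSingularities.ResolutionOfSingularities.Cruxes.EquisingularLiftNat.Sections

end
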